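import Literature.AnabelianGeometry.SemiGraphs.ProfiniteSemiGraphHomRestrict
import Literature.AnabelianGeometry.SemiGraphs.TemperedDecompositionSubgroups
import Literature.AnabelianGeometry.SemiGraphs.TemperedReconstruction
import HarnessLib

/-!
# Decomposition subgroups `Π^tp_ℍ ⊆ Π^tp_𝔾` transport along isomorphisms of semi-graphs of anabelioids
# ([IUTchI] §2 p. 44, Cor. 2.3 (i) p. 47; [SemiAnbd] Prop. 3.6 (iv) p. 39) — GAP-LEDGER G-w4d052-g6-1 (P4-i)

Mochizuki, *Inter-universal Teichmüller theory I*, §2 p. 44 l. 39–44 (for a connected sub-semi-graph `ℍ ⊆ 𝔾`: "we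
obtain natural … decomposition groups `Π^tp_ℍ ⊆ Π^tp_𝔾` … well-defined up to `Π^tp_𝔾`-conjugacy … natural commutative
diagram"), p. 47 l. 22–24 ("the sub-semi-graph `ℍ ⊆ 𝔾` is stabilized by the natural action of `G_k` on `𝔾`"), Cor. 2.3 (i)
p. 47 ("the natural outer actions of `G_k` on `Δ^tp_X` … determine natural outer actions of `G_k` on `Δ^tp_{X,ℍ}`")
[cite: Mochizuki2012, IUTchI Cor 2.3(i) p.47] [claim: Mochizuki2012, status: disputed] (nothing of the series is asserted;
PROVED are the displayed statements about the tree's objects); Mochizuki, *Semi-graphs of anabelioids*, Publ. RIMS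
**42** (2006), Prop. 3.6 (iv) p. 39 (functoriality of `B^temp`, `π₁^temp`), Prop. 3.2 p. 35 (morphisms of temperoids =
outer homomorphisms) [cite: MochizukiSemiAnbd2006, Prop 3.6(iv) p.39].

PROOF-ONLY (abc-iut cell; row «DECOMP-TRANSPORT-FUNCTORIALITY» = GAP-LEDGER G-w4d052-g6-1 part (P4-i), seat
abc-iut-w4-d052 gen 6, L5-lead RULINGS #104 GO).  The decomposition subgroups `decompSubgroups c ℍ` (abc-iut-w4-d052,
`TemperedDecompositionSubgroups.lean`) are FUNCTORIAL:

* `IsDecompHom.comp_of_compat` — abstract transport: if `θ : π₁^temp(𝒢) → π₁^temp(ℋ)` is induced by a functor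
  `P : B^temp(ℋ) ⥤ B^temp(𝒢)` (`cℋ⁻¹ ⋙ P ⋙ c𝒢 ≅ B^temp(θ)`) which RESTRICTS to an equivalence
  `E : B^temp(ℋ_{ℍ′}) ≌ B^temp(𝒢_ℍ)` (`(−)|_{ℍ′} ⋙ E ≅ P ⋙ (−)|_ℍ`), then `θ ∘ φ` is a decomposition homomorphism of
  `ℍ′` (chart: the transport of `φ`'s chart along `E`) for every decomposition homomorphism `φ` of `ℍ` — pure
  temperoid algebra over `TemperedPiChart.transport`;
* **`map_mem_decompSubgroups_of_induces`** — for an ISOMORPHISM `F : 𝒢 → ℋ` of semi-graphs of anabelioids (locally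
  trivial, iso on underlying semi-graphs), charts `c𝒢`, `cℋ`, `θ` with `F.Induces c𝒢 cℋ θ` (abc-iut-L3-t2's Prop. 3.6 (iv)
  form), and sub-semi-graphs `ℍ = F⁻¹(ℍ′)`: **`D ∈ decompSubgroups c𝒢 ℍ ⇒ θ(D) ∈ decompSubgroups cℋ ℍ′`** — `P := F^*`,
  `E := (F|_ℍ)^*` (abc-iut-L3-d6's `Hom.btempPullbackEquiv` for the restricted morphism `Hom.restrictSub`,
  `ProfiniteSemiGraphHomRestrict.lean`), compatibility = `Hom.btempRestrictPullbackIso`;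
* `exists_conj_map_eq_of_induces` — for an AUTOMORPHISM `F : 𝒢 → 𝒢` STABILISING `ℍ` (`ℍ = F⁻¹ℍ`) inducing `θ` on one
  chart: `θ(D)` is a `π₁^temp(𝒢)`-CONJUGATE of `D` (two decomposition subgroups of one `ℍ` are conjugate,
  `exists_conj_of_mem_decompSubgroups`) — the group-level form `hHstab` of [IUTchI] Cor. 2.3's hypothesis "`ℍ` is
  stabilized by `G_k`" for EVERY decomposition group, GIVEN that the Galois action on `Π^tp_𝔾` is induced by
  automorphisms of the semi-graph of anabelioids `𝔾` stabilising `ℍ` (part (P4-ii) of the gap row: an ORIGIN datum /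
  [SemiAnbd] Cor. 3.9 instance, NOT supplied here).

Theorems only: no `def`, no instance, no new `Prop` fact; nothing here bears on [IUTchIII] Cor. 3.12 or asserts that abc
is proved or refuted.
-/

noncomputable section

namespace Literature.AnabelianGeometry.SemiGraphs

namespace ProfiniteSemiGraph

namespace TemperedPiChart

open CategoryTheory

universe u

/-! ### Abstract transport of decomposition homomorphisms along compatible functors -/

/-- **Abstract transport.**  `θ : π₁^temp(𝒢) → π₁^temp(ℋ)` induced (through the charts `c𝒢`, `cℋ`) by a functor
`P : B^temp(ℋ) ⥤ B^temp(𝒢)` that restricts, up to isomorphism, to an EQUIVALENCE `E : B^temp(ℋ_{ℍ′}) ≌ B^temp(𝒢_ℍ)` of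
the restricted temperoids; then for every decomposition homomorphism `φ` of `ℍ` (chart `c₁` of `𝒢_ℍ`), `θ ∘ φ` is a
decomposition homomorphism of `ℍ′` for the transported chart `c₁.transport E` (same group).
[cite: MochizukiSemiAnbd2006, Prop 3.6(iv) p.39] -/
theorem IsDecompHom.comp_of_compat {𝒢 ℋ : ProfiniteSemiGraph.{u}} {c𝒢 : TemperedPiChart 𝒢}
    {cℋ : TemperedPiChart ℋ} {H : 𝒢.graph.Subgraph} {H' : ℋ.graph.Subgraph}
    (P : BTempCat ℋ ⥤ BTempCat 𝒢) {θ : c𝒢.G →ₜ* cℋ.G}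
    (hP : Nonempty (cℋ.equiv.inverse ⋙ P ⋙ c𝒢.equiv.functor ≅ BTemp.res θ))
    (E : BTempCat (ℋ.restrict H') ≌ BTempCat (𝒢.restrict H))
    (hE : Nonempty (ℋ.btempRestrict H' ⋙ E.functor ≅ P ⋙ 𝒢.btempRestrict H))
    {c₁ : TemperedPiChart (𝒢.restrict H)} {φ : c₁.G →ₜ* c𝒢.G} (hφ : c𝒢.IsDecompHom H c₁ φ) :
    cℋ.IsDecompHom H' (c₁.transport E) (θ.comp φ) := by
  obtain ⟨iP⟩ := hP
  obtain ⟨iE⟩ := hE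
  obtain ⟨iφ⟩ := hφ
  -- `c𝒢⁻¹ ⋙ |_ℍ ⋙ c₁ ≅ res φ`, whiskered on the left by `cℋ⁻¹ ⋙ P ⋙ c𝒢` and then by `res θ`
  refine ⟨?_⟩
  calc cℋ.equiv.inverse ⋙ ℋ.btempRestrict H' ⋙ (c₁.transport E).equiv.functor
      ≅ cℋ.equiv.inverse ⋙ (ℋ.btempRestrict H' ⋙ E.functor) ⋙ c₁.equiv.functor := Iso.refl _
    _ ≅ cℋ.equiv.inverse ⋙ (P ⋙ 𝒢.btempRestrict H) ⋙ c₁.equiv.functor :=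
        Functor.isoWhiskerLeft _ (Functor.isoWhiskerRight iE _)
    _ ≅ (cℋ.equiv.inverse ⋙ P ⋙ 𝟭 (BTempCat 𝒢)) ⋙ 𝒢.btempRestrict H ⋙ c₁.equiv.functor := Iso.refl _
    _ ≅ (cℋ.equiv.inverse ⋙ P ⋙ (c𝒢.equiv.functor ⋙ c𝒢.equiv.inverse)) ⋙
          𝒢.btempRestrict H ⋙ c₁.equiv.functor :=
        Functor.isoWhiskerRight (Functor.isoWhiskerLeft _ (Functor.isoWhiskerLeft _ c𝒢.equiv.unitIso)) _
    _ ≅ (cℋ.equiv.inverse ⋙ P ⋙ c𝒢.equiv.functor) ⋙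
          (c𝒢.equiv.inverse ⋙ 𝒢.btempRestrict H ⋙ c₁.equiv.functor) := Iso.refl _
    _ ≅ BTemp.res θ ⋙ BTemp.res φ := Functor.isoWhiskerRight iP _ ≪≫ Functor.isoWhiskerLeft _ iφ
    _ ≅ BTemp.res (θ.comp φ) := BTemp.resComp θ φ

/-- Hence the transported subgroup: `θ(range φ) = range (θ ∘ φ)` is a decomposition subgroup of `ℍ′`.
[cite: Mochizuki2012, IUTchI §2 p.44] -/
theorem map_mem_decompSubgroups_of_compat {𝒢 ℋ : ProfiniteSemiGraph.{u}} {c𝒢 : TemperedPiChart 𝒢}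
    {cℋ : TemperedPiChart ℋ} {H : 𝒢.graph.Subgraph} {H' : ℋ.graph.Subgraph}
    (P : BTempCat ℋ ⥤ BTempCat 𝒢) {θ : c𝒢.G →ₜ* cℋ.G}
    (hP : Nonempty (cℋ.equiv.inverse ⋙ P ⋙ c𝒢.equiv.functor ≅ BTemp.res θ))
    (E : BTempCat (ℋ.restrict H') ≌ BTempCat (𝒢.restrict H))
    (hE : Nonempty (ℋ.btempRestrict H' ⋙ E.functor ≅ P ⋙ 𝒢.btempRestrict H))
    {D : Subgroup c𝒢.G} (hD : D ∈ c𝒢.decompSubgroups H) :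
    D.map θ.toMonoidHom ∈ cℋ.decompSubgroups H' := by
  obtain ⟨c₁, φ, hφ, rfl⟩ := hD
  exact ⟨c₁.transport E, θ.comp φ, hφ.comp_of_compat P hP E hE, (MonoidHom.range_comp _ _).symm⟩

/-! ### Transport along an isomorphism of semi-graphs of anabelioids -/

/-- **Decomposition subgroups transport along isomorphisms of semi-graphs of anabelioids** ([SemiAnbd] Prop. 3.6
(iv); [IUTchI] §2 p. 44): for `F : 𝒢 → ℋ` locally trivial and an isomorphism on underlying semi-graphs, charts `c𝒢`,
`cℋ` and `θ : π₁^temp(𝒢) → π₁^temp(ℋ)` INDUCED by `F` (`F.Induces c𝒢 cℋ θ`: `B^temp(θ) ≅ cℋ⁻¹ ⋙ F^* ⋙ c𝒢`), and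
sub-semi-graphs with `ℍ = F⁻¹(ℍ′)` (vertex- and edge-wise), the image `θ(D)` of every decomposition subgroup
`D ∈ decompSubgroups c𝒢 ℍ` is a decomposition subgroup of `ℍ′`: `P := F^*`, `E := (F|_ℍ)^*` (an equivalence,
abc-iut-L3-d6's `Hom.btempPullbackEquiv` for `Hom.restrictSub`), compatibility `Hom.btempRestrictPullbackIso`.
[cite: MochizukiSemiAnbd2006, Prop 3.6(iv) p.39] -/
theorem map_mem_decompSubgroups_of_induces {𝒢 ℋ : ProfiniteSemiGraph.{u}} (F : Hom 𝒢 ℋ)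
    (hlt : F.IsLocallyTrivial) [CategoryTheory.IsIso (C := SemiGraph.{u}) F.base] (c𝒢 : TemperedPiChart 𝒢)
    (cℋ : TemperedPiChart ℋ) {θ : c𝒢.G →ₜ* cℋ.G} (hθ : F.Induces c𝒢 cℋ θ) {H : 𝒢.graph.Subgraph}
    {H' : ℋ.graph.Subgraph} (hV : ∀ v, v ∈ H.verts ↔ F.base.vertexMap v ∈ H'.verts)
    (hE : ∀ e, e ∈ H.edges ↔ F.base.edgeMap e ∈ H'.edges) {D : Subgroup c𝒢.G}
    (hD : D ∈ c𝒢.decompSubgroups H) : D.map θ.toMonoidHom ∈ cℋ.decompSubgroups H' := by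
  have hV₁ : H.verts ⊆ F.base.vertexMap ⁻¹' H'.verts := fun v hv => (hV v).mp hv
  have hE₁ : H.edges ⊆ F.base.edgeMap ⁻¹' H'.edges := fun e he => (hE e).mp he
  haveI := F.isIso_restrictSub_base H H' hV₁ hE₁ (fun v hv => (hV v).mpr hv) (fun e he => (hE e).mpr he)
  exact map_mem_decompSubgroups_of_compat F.btempPullback hθ
    ((F.restrictSub H H' hV₁ hE₁).btempPullbackEquiv (hlt.restrictSub H H' hV₁ hE₁)
      (F.chosenConjugators.restrictSub H H' hV₁ hE₁))
    ⟨(F.btempRestrictPullbackIso H H' hV₁ hE₁ F.chosenConjugators).symm⟩ hD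

/-- **The group-level `hHstab` from an `ℍ`-STABILISING automorphism**: for `F : 𝒢 → 𝒢` locally trivial, iso on the
underlying semi-graph, with `F⁻¹(ℍ) = ℍ`, inducing `θ` on a chart `c`, and any `D ∈ decompSubgroups c ℍ`: `θ(D)` is a
`π₁^temp(𝒢)`-conjugate of `D` (both are decomposition subgroups of `ℍ`, a single conjugacy class:
`exists_conj_of_mem_decompSubgroups`) — [IUTchI] Cor. 2.3 (i) "the natural outer actions of `G_k` on `Δ^tp_X` determine
natural outer actions of `G_k` on `Δ^tp_{X,ℍ}`", group form, GIVEN that the Galois action on `Π^tp_𝔾` comes from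
automorphisms of `𝔾` stabilising `ℍ`. [cite: Mochizuki2012, IUTchI Cor 2.3(i) p.47] -/
theorem exists_conj_map_eq_of_induces {𝒢 : ProfiniteSemiGraph.{u}} (F : Hom 𝒢 𝒢) (hlt : F.IsLocallyTrivial)
    [CategoryTheory.IsIso (C := SemiGraph.{u}) F.base] (c : TemperedPiChart 𝒢) {θ : c.G →ₜ* c.G} (hθ : F.Induces c c θ)
    {H : 𝒢.graph.Subgraph} (hV : ∀ v, v ∈ H.verts ↔ F.base.vertexMap v ∈ H.verts)
    (hE : ∀ e, e ∈ H.edges ↔ F.base.edgeMap e ∈ H.edges) {D : Subgroup c.G} (hD : D ∈ c.decompSubgroups H) :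
    ∃ g : c.G, D.map θ.toMonoidHom = D.map (MulAut.conj g).toMonoidHom :=
  exists_conj_of_mem_decompSubgroups hD (map_mem_decompSubgroups_of_induces F hlt c c hθ hV hE hD)

end TemperedPiChart

end ProfiniteSemiGraph

end Literature.AnabelianGeometry.SemiGraphs

end
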